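import Summits.QuantumFields.BalabanUV.T4Continuum.Support.ShellMeasureLinearizedRealForm

/-!
# `T4Continuum.ShellMeasureLinearizedRealStructure` — (LR)_j: THE REAL FORM CONSTRUCTED.  The hypothesis-style real
# form `(E, F, ιE, πE, ιF, πF; five axioms)` of `ShellMeasureLinearizedRealForm` IS the pair of FIXED-POINT SUBSPACES
# `Fix(κ_𝒴)`, `Fix(κ_𝒳)` of the conjugations already among `B12JacobianReal267`'s binders, with the inclusion and the
# real-part projection `B ↦ ½(B + κ B)`; the five axioms are THEOREMS, and the curved-chart ENDs' real chart data follow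
# from EXACTLY the B12 leaves' binder list
(cell `pub-balaban`, sub-cell `t4`, spine estimate NE7c (node U5b); NE7c formalisation swarm, crew seat
`b2b-balaban-t4-ne7c-formalise-leaf-09` gen 8 — idle-seat OFFER inside the seat's own lineage orbit (row S33 «(LR)_j
LINEARIZABLE — curved fibre chart», journal `CLAIMS.log` «THE REAL FORM CONSTRUCTED»); imports leaf-02-g5's
`ShellMeasureLinearizedRealForm` (p216819) ONLY (hence leaf-09-g7's `ShellMeasureLinearizedConstraint` p216585 and the
Literature leaves `B12JacobianReal267` / `B12Lineariz267` / `B12LinearizAnalytic267` / `B13Contraction113`);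
[folklore] linear algebra; data `def`s only (`conjR`, `realSub`, `incl`, `reP`, `realFormEquiv`, `negStar`; one
`CompleteSpace` instance), 0 `def … : Prop`, 0 sorry, 0 citations)

HONEST FRAMING.  Finite four-torus programme, rung (B)+1 only — NOT infinite volume, NOT a mass gap, NOT the Clay
problem, NOT summit progress; (B), `BetaPertHyp`, (B^μ) not consumed.  NE7c (`T4IndicatorShell.ShellWeightBound`) is
NOT PRINTED and NOT PROVED; «NE7c ⇐ the named binders».  Nothing of [Balaban 1983–89] is asserted: the complex data
(`hop`, the quadratic-analytic `C̃`, the hypothesis-style solution `D̃` on `‖B‖ < ε`, the conjugations `κ_𝒳`, `κ_𝒴` with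
involutivity and equivariance) stay displayed-TYPE binders EXACTLY as in `B12JacobianReal267`; what this file REMOVES
is only the EXTRA hypothesis-style real form of `ShellMeasureLinearizedRealForm` — it is CONSTRUCTED here.  The
concrete lattice real structure of [B12] (`𝔰𝔲(n)`-valued block fields with Bałaban's norms) is NOT instantiated: §3
only shows that the abstraction is inhabited by its KIND (`X ↦ −X⋆` on a complex normed star-module, fixed points =
the skew-adjoint = anti-Hermitian part; the trace-zero condition and the lattice norms are located, not built).

THE POINT.  `ShellMeasureLinearizedRealForm.realForm_chartData` derives the four real inputs `hΦm`/`hinj`/`hΦ'`/`hlin`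
of leaf-09-g7's curved-chart ENDs (`ShellMeasureLinearizedChart` §3–§4, `ShellMeasureLinearizedConstraint` §2) from
print's COMPLEXIFIED substitution `B ↦ B − hD̃(B)` ([Balaban1987RG1] p. 267, typed over complex Banach spaces `𝒴`, `𝒳`
with conjugations), GIVEN real normed spaces `E`, `F` and real CLMs `ιE : E → 𝒴`, `πE : 𝒴 → E`, `ιF`, `πF` with
`hιπE : κ_𝒴 B = B → ιE (πE B) = B`, `hιEr : κ_𝒴 (ιE y) = ιE y`, `hιπF`, `hιFr`, `hπιF : πF (ιF x) = x`.  Here: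
* §1 for ANY conjugate-linear isometric `κ : 𝒴 ≃ₗᵢ⋆[ℂ] 𝒴`: the conjugation as a REAL continuous linear map `conjR κ`
  (`κ (r • B) = r • κ B` for real `r`), the REAL SUBSPACE `realSub κ := {B | κ B = B}` (a closed real submodule —
  complete, and finite-dimensional / Borel whenever `𝒴` is), and for an INVOLUTIVE `κ` the REAL-PART PROJECTION
  `reP κ hκ : 𝒴 →L[ℝ] realSub κ`, `B ↦ ½(B + κ B)`, and the inclusion `incl κ := (realSub κ).subtypeL`; the five axioms
  as theorems — `conj_incl` (hιEr/hιFr), `incl_reP_of_fixed` (hιπE/hιπF), `reP_incl` (hπιF, and the sixth axiom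
  `hπιE : πE (ιE y) = y` asked by `ShellMeasureLinearizedJacobian`) — plus `‖reP B‖ ≤ ‖B‖`, `range ι = Fix κ`, `incl`
  injective and isometric, and the REAL-FORM DECOMPOSITION `B = ι(reP B) + i·ι(reP (−i·B))` with uniqueness
  (`𝒴 = E ⊕ iE` as a real linear equivalence `realFormEquiv : 𝒴 ≃ₗ[ℝ] E × E`; hence `finrank ℝ E = finrank ℂ 𝒴`).
* §2 **`realForm_chartData_fixed`** = `realForm_chartData` APPLIED with `E := realSub κ_𝒴`, `ιE := incl κ_𝒴`,
  `πE := reP κ_𝒴 hκY`, `F := realSub κ_𝒳`, `ιF := incl κ_𝒳`, `πF := reP κ_𝒳 hκX`: the real chart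
  `B ↦ B − h (D̃_ℝ B)` on `E = Fix(κ_𝒴)` is MEASURABLE, INJECTIVE on the real window, DIFFERENTIABLE within it, and
  LINEARIZES the real average — from EXACTLY `B12JacobianReal267`'s binders (+ the left inverse `LQ` of `hop`,
  analyticity of `C̃`, a splitting `Ψ`), NO real-form hypothesis left.
* §3 the abstraction is inhabited by print's KIND of real structure: on a complex normed star-module with isometric
  star, `negStar := X ↦ −X⋆` is a conjugate-linear isometric involution with `Fix(negStar) = skewAdjoint`
  (anti-Hermitian; for matrix blocks the `𝔲(n)`-type real form) and `reP = X ↦ ½(X − X⋆)`.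
WHICH END / BINDER: consumed by nothing new — it FEEDS `ShellMeasureLinearizedRealForm` §4 → `…LinearizedConstraint`
§2 → `…LinearizedChart` §3–§4 (row S33); REMOVES the hypothesis-style real form from the (LR)_j linearizable road;
mints nothing (trigger c2).  What STAYS displayed on that road is otherwise unchanged: print's claim that the block
average about the step's background IS `LQ + C̃` with `C̃` quadratic-analytic in the contraction regime (B12 p. 267
(2.10)–(2.12) TYPE, `B12Lineariz267`), the [dict] identification of the slot density, E2′'s SM-L1…L6 in the fibre
coordinate.  NOTHING in the countdown moves; NE7c NOT PROVED; spine PROVED 0/9.  HONEST DEPENDENCY (cell): continuum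
YM on T⁴ ⇐ BetaPertH ∧ nine spine estimates (0/9 proved); BetaPertH ⇐ (D1) ∧ (D4) ∧ CAP+tail; G-an2-4 gates asym, D1
and NE2/3/4.
-/

noncomputable section

open Set Metric Filter Topology

namespace Summit.QuantumFields.BalabanUV.T4Continuum.ShellMeasureLinearizedRealStructure

open Literature.MathematicalPhysics.QuantumFieldTheory.Balaban1983to89
open B12JacobianReal267 (conj_real_smul isClosed_fixed)

/-! ## §1 The real subspace of a conjugation and the real-part projection -/

section RealSubspace

variable {𝒴 : Type*} [NormedAddCommGroup 𝒴] [NormedSpace ℂ 𝒴]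

/-- THE CONJUGATION AS A REAL CONTINUOUS LINEAR MAP (norm bound `1`; `conjR κ B = κ B`) — real-linearity is
`B12JacobianReal267.conj_real_smul` BY NAME. [folklore] -/
def conjR (κ : 𝒴 ≃ₗᵢ⋆[ℂ] 𝒴) : 𝒴 →L[ℝ] 𝒴 :=
  LinearMap.mkContinuous
    { toFun := κ
      map_add' := map_add κ
      map_smul' := fun r B => conj_real_smul κ r B }
    1 fun B => by simp only [LinearMap.coe_mk, AddHom.coe_mk, LinearIsometryEquiv.norm_map, one_mul, le_refl]

/-- `conjR κ` acts as `κ`. [folklore] -/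
@[simp] theorem conjR_apply (κ : 𝒴 ≃ₗᵢ⋆[ℂ] 𝒴) (B : 𝒴) : conjR κ B = κ B := rfl

/-- THE REAL SUBSPACE `Fix(κ) = {B | κ B = B}` of the conjugation, as a real submodule of `𝒴` (the real — «𝐠-valued» —
fields inside the complexified configuration space). [folklore] -/
def realSub (κ : 𝒴 ≃ₗᵢ⋆[ℂ] 𝒴) : Submodule ℝ 𝒴 :=
  LinearMap.eqLocus (conjR κ).toLinearMap LinearMap.id

/-- membership in the real subspace is the fixed-point equation. [folklore] -/
@[simp] theorem mem_realSub {κ : 𝒴 ≃ₗᵢ⋆[ℂ] 𝒴} {B : 𝒴} : B ∈ realSub κ ↔ κ B = B :=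
  LinearMap.mem_eqLocus

/-- the carrier of the real subspace. [folklore] -/
theorem coe_realSub (κ : 𝒴 ≃ₗᵢ⋆[ℂ] 𝒴) : (realSub κ : Set 𝒴) = {B | κ B = B} :=
  Set.ext fun _ => mem_realSub

/-- the real subspace is CLOSED (`B12JacobianReal267.isClosed_fixed` BY NAME; it is also real-convex, `convex_fixed`).
[folklore] -/
theorem isClosed_realSub (κ : 𝒴 ≃ₗᵢ⋆[ℂ] 𝒴) : IsClosed (realSub κ : Set 𝒴) := by
  rw [coe_realSub]
  exact isClosed_fixed κ

/-- the real subspace of a Banach space is complete. [folklore] -/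
instance instCompleteSpaceRealSub [CompleteSpace 𝒴] (κ : 𝒴 ≃ₗᵢ⋆[ℂ] 𝒴) : CompleteSpace (realSub κ) :=
  (isClosed_realSub κ).completeSpace_coe

/-- THE INCLUSION `ι : Fix(κ) → 𝒴` of the real subspace (the submodule's `subtypeL`, a real CLM) — the `ιE`/`ιF` of
`ShellMeasureLinearizedRealForm`. [folklore] -/
abbrev incl (κ : 𝒴 ≃ₗᵢ⋆[ℂ] 𝒴) : realSub κ →L[ℝ] 𝒴 := (realSub κ).subtypeL

/-- the inclusion is the coercion. [folklore] -/
@[simp] theorem incl_apply (κ : 𝒴 ≃ₗᵢ⋆[ℂ] 𝒴) (y : realSub κ) : incl κ y = (y : 𝒴) := rfl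

/-- the inclusion is injective. [folklore] -/
theorem incl_injective (κ : 𝒴 ≃ₗᵢ⋆[ℂ] 𝒴) : Function.Injective (incl κ) :=
  fun _ _ h => Subtype.ext (by rwa [incl_apply, incl_apply] at h)

/-- vectors of the real subspace are `κ`-fixed — axiom `hιEr`/`hιFr` of `ShellMeasureLinearizedRealForm` for the
inclusion `ι := incl κ`. [folklore] -/
theorem conj_incl (κ : 𝒴 ≃ₗᵢ⋆[ℂ] 𝒴) (y : realSub κ) : κ (incl κ y) = incl κ y := by
  rw [incl_apply]
  exact mem_realSub.1 y.2

/-- the inclusion is isometric. [folklore] -/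
theorem norm_incl (κ : 𝒴 ≃ₗᵢ⋆[ℂ] 𝒴) (y : realSub κ) : ‖incl κ y‖ = ‖y‖ := by
  rw [incl_apply, Submodule.norm_coe]

/-- the range of the inclusion is EXACTLY the set of real fields `{B | κ B = B}` — the clause «`ιE` real-valued» of
`ShellMeasureLinearizedRealForm`'s header. [folklore] -/
theorem range_incl (κ : 𝒴 ≃ₗᵢ⋆[ℂ] 𝒴) : range (incl κ) = {B | κ B = B} := by
  ext B
  constructor
  · rintro ⟨y, rfl⟩
    exact conj_incl κ y
  · intro hB
    exact ⟨⟨B, mem_realSub.2 hB⟩, rfl⟩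

/-- for an involutive conjugation, `½(B + κ B)` is a real field. [folklore] -/
theorem half_add_conj_mem {κ : 𝒴 ≃ₗᵢ⋆[ℂ] 𝒴} (hκ : ∀ B, κ (κ B) = B) (B : 𝒴) :
    (1 / 2 : ℝ) • (B + κ B) ∈ realSub κ := by
  rw [mem_realSub, conj_real_smul, map_add, hκ, add_comm]

/-- THE REAL-PART PROJECTION `B ↦ ½(B + κ B)` onto the real subspace of an INVOLUTIVE conjugation (a real CLM).
[folklore] -/
def reP (κ : 𝒴 ≃ₗᵢ⋆[ℂ] 𝒴) (hκ : ∀ B, κ (κ B) = B) : 𝒴 →L[ℝ] realSub κ :=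
  ((1 / 2 : ℝ) • (ContinuousLinearMap.id ℝ 𝒴 + conjR κ)).codRestrict (realSub κ) fun B => by
    simpa only [smul_apply, add_apply, ContinuousLinearMap.id_apply, conjR_apply] using half_add_conj_mem hκ B

/-- the value of the real-part projection. [folklore] -/
@[simp] theorem coe_reP {κ : 𝒴 ≃ₗᵢ⋆[ℂ] 𝒴} (hκ : ∀ B, κ (κ B) = B) (B : 𝒴) :
    ((reP κ hκ B : realSub κ) : 𝒴) = (1 / 2 : ℝ) • (B + κ B) := rfl

/-- `ι (reP B) = ½(B + κ B)`. [folklore] -/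
theorem incl_reP {κ : 𝒴 ≃ₗᵢ⋆[ℂ] 𝒴} (hκ : ∀ B, κ (κ B) = B) (B : 𝒴) :
    incl κ (reP κ hκ B) = (1 / 2 : ℝ) • (B + κ B) := by
  rw [incl_apply, coe_reP]

/-- **axiom `hιπE`/`hιπF` of `ShellMeasureLinearizedRealForm` as a theorem**: on real fields the projection followed by
the inclusion is the identity — `κ B = B → ι (reP B) = B`. [folklore] -/
theorem incl_reP_of_fixed {κ : 𝒴 ≃ₗᵢ⋆[ℂ] 𝒴} (hκ : ∀ B, κ (κ B) = B) (B : 𝒴) (hB : κ B = B) :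
    incl κ (reP κ hκ B) = B := by
  rw [incl_reP, hB, ← two_smul ℝ B, smul_smul, show (1 / 2 * 2 : ℝ) = 1 by norm_num, one_smul]

/-- **axiom `hπιF` (and `πE ∘ ιE = id`) as a theorem**: `reP (ι y) = y`. [folklore] -/
theorem reP_incl {κ : 𝒴 ≃ₗᵢ⋆[ℂ] 𝒴} (hκ : ∀ B, κ (κ B) = B) (y : realSub κ) :
    reP κ hκ (incl κ y) = y := by
  apply Subtype.ext
  have h := incl_reP_of_fixed hκ _ (conj_incl κ y)
  rwa [incl_apply, incl_apply] at h

/-- the projection is onto. [folklore] -/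
theorem reP_surjective {κ : 𝒴 ≃ₗᵢ⋆[ℂ] 𝒴} (hκ : ∀ B, κ (κ B) = B) : Function.Surjective (reP κ hκ) :=
  fun y => ⟨incl κ y, reP_incl hκ y⟩

/-- the projection does not increase norms: `‖reP B‖ ≤ ‖B‖`. [folklore] -/
theorem norm_reP_le {κ : 𝒴 ≃ₗᵢ⋆[ℂ] 𝒴} (hκ : ∀ B, κ (κ B) = B) (B : 𝒴) : ‖reP κ hκ B‖ ≤ ‖B‖ := by
  rw [← norm_incl κ, incl_reP, norm_smul, Real.norm_of_nonneg (by norm_num : (0 : ℝ) ≤ 1 / 2)]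
  calc (1 / 2 : ℝ) * ‖B + κ B‖ ≤ (1 / 2) * (‖B‖ + ‖κ B‖) := by gcongr; exact norm_add_le _ _
    _ = ‖B‖ := by rw [LinearIsometryEquiv.norm_map]; ring

/-- the IMAGINARY PART is the real part of `−i·B`: `i · ι(reP (−i·B)) = ½(B − κ B)`. [folklore] -/
theorem I_smul_incl_reP_negI {κ : 𝒴 ≃ₗᵢ⋆[ℂ] 𝒴} (hκ : ∀ B, κ (κ B) = B) (B : 𝒴) :
    (Complex.I : ℂ) • incl κ (reP κ hκ (-Complex.I • B)) = (1 / 2 : ℝ) • (B - κ B) := by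
  rw [incl_reP, LinearIsometryEquiv.map_smulₛₗ, map_neg, Complex.conj_I, neg_neg,
    smul_comm Complex.I (1 / 2 : ℝ) (-Complex.I • B + Complex.I • κ B), smul_add, smul_smul, smul_smul, mul_neg,
    Complex.I_mul_I, neg_neg, one_smul, neg_one_smul, ← sub_eq_add_neg]

/-- **THE REAL-FORM DECOMPOSITION `𝒴 = E ⊕ iE`** (existence): `B = ι(reP B) + i · ι(reP (−i·B))`. [folklore] -/
theorem realForm_decomposition {κ : 𝒴 ≃ₗᵢ⋆[ℂ] 𝒴} (hκ : ∀ B, κ (κ B) = B) (B : 𝒴) :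
    B = incl κ (reP κ hκ B) + (Complex.I : ℂ) • incl κ (reP κ hκ (-Complex.I • B)) := by
  have e : B + κ B + (B - κ B) = (2 : ℝ) • B := by rw [two_smul]; abel
  rw [I_smul_incl_reP_negI hκ, incl_reP hκ, ← smul_add, e, smul_smul,
    show (1 / 2 * 2 : ℝ) = 1 by norm_num, one_smul]

/-- the real part of a decomposed vector: `B = ι y₁ + i · ι y₂` with `y₁`, `y₂` real ⟹ `reP B = y₁`. [folklore] -/
theorem reP_eq_of_decomposition {κ : 𝒴 ≃ₗᵢ⋆[ℂ] 𝒴} (hκ : ∀ B, κ (κ B) = B) {B : 𝒴} {y₁ y₂ : realSub κ}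
    (h : B = incl κ y₁ + (Complex.I : ℂ) • incl κ y₂) : reP κ hκ B = y₁ := by
  have h₁ : κ (incl κ y₁) = incl κ y₁ := conj_incl κ y₁
  have h₂ : κ (incl κ y₂) = incl κ y₂ := conj_incl κ y₂
  have hκB : κ B = incl κ y₁ - (Complex.I : ℂ) • incl κ y₂ := by
    rw [h, map_add, LinearIsometryEquiv.map_smulₛₗ, Complex.conj_I, h₁, h₂, neg_smul, sub_eq_add_neg]
  have e : incl κ y₁ + (Complex.I : ℂ) • incl κ y₂ +
      (incl κ y₁ - (Complex.I : ℂ) • incl κ y₂) = (2 : ℝ) • incl κ y₁ := by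
    rw [two_smul]; abel
  apply Subtype.ext
  rw [coe_reP, hκB, h, e, smul_smul, show (1 / 2 * 2 : ℝ) = 1 by norm_num, one_smul, incl_apply]

/-- **THE REAL-FORM DECOMPOSITION** (uniqueness): if `B = ι y₁ + i · ι y₂` with `y₁`, `y₂` real, then `y₁ = reP B` and
`y₂ = reP (−i·B)`. [folklore] -/
theorem realForm_decomposition_unique {κ : 𝒴 ≃ₗᵢ⋆[ℂ] 𝒴} (hκ : ∀ B, κ (κ B) = B) {B : 𝒴} {y₁ y₂ : realSub κ}
    (h : B = incl κ y₁ + (Complex.I : ℂ) • incl κ y₂) :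
    y₁ = reP κ hκ B ∧ y₂ = reP κ hκ (-Complex.I • B) := by
  have h' : -Complex.I • B = incl κ y₂ + (Complex.I : ℂ) • incl κ (-y₁) := by
    rw [h, smul_add, smul_smul, neg_mul, Complex.I_mul_I, neg_neg, one_smul, map_neg, smul_neg, neg_smul, add_comm]
  exact ⟨(reP_eq_of_decomposition hκ h).symm, (reP_eq_of_decomposition hκ h').symm⟩

/-- **THE REAL-FORM COORDINATES `𝒴 ≃ E × E`**: `B ↦ (reP B, reP (−i·B))` with inverse `(y₁, y₂) ↦ ι y₁ + i · ι y₂`,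
as a REAL linear equivalence. [folklore] -/
def realFormEquiv (κ : 𝒴 ≃ₗᵢ⋆[ℂ] 𝒴) (hκ : ∀ B, κ (κ B) = B) : 𝒴 ≃ₗ[ℝ] (realSub κ × realSub κ) where
  toFun B := (reP κ hκ B, reP κ hκ (-Complex.I • B))
  invFun p := incl κ p.1 + (Complex.I : ℂ) • incl κ p.2
  map_add' B C := by rw [smul_add, map_add, map_add, Prod.mk_add_mk]
  map_smul' r B := by
    rw [RingHom.id_apply, Prod.smul_mk, smul_comm (-Complex.I) r B, map_smul (reP κ hκ) r B,
      map_smul (reP κ hκ) r (-Complex.I • B)]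
  left_inv B := (realForm_decomposition hκ B).symm
  right_inv p := by
    obtain ⟨h₁, h₂⟩ := realForm_decomposition_unique hκ
      (B := incl κ p.1 + (Complex.I : ℂ) • incl κ p.2) (y₁ := p.1) (y₂ := p.2) rfl
    exact Prod.ext h₁.symm h₂.symm

/-- the real-form coordinates of `B`. [folklore] -/
@[simp] theorem realFormEquiv_apply {κ : 𝒴 ≃ₗᵢ⋆[ℂ] 𝒴} (hκ : ∀ B, κ (κ B) = B) (B : 𝒴) :
    realFormEquiv κ hκ B = (reP κ hκ B, reP κ hκ (-Complex.I • B)) := rfl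

/-- **`dim_ℝ Fix(κ) = dim_ℂ 𝒴`** — a real basis of the real form has the size of a complex basis of `𝒴` (the count
`finrank ℝ E = finrank ℂ 𝒴` of `ShellMeasureLinearizedJacobian`'s determinant bookkeeping, for the constructed form).
[folklore] -/
theorem finrank_realSub [FiniteDimensional ℂ 𝒴] {κ : 𝒴 ≃ₗᵢ⋆[ℂ] 𝒴} (hκ : ∀ B, κ (κ B) = B) :
    Module.finrank ℝ (realSub κ) = Module.finrank ℂ 𝒴 := by
  have h := (realFormEquiv κ hκ).finrank_eq
  rw [Module.finrank_prod, finrank_real_of_complex] at h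
  omega

end RealSubspace

/-! ## §2 The junction: `realForm_chartData` with the real form CONSTRUCTED -/

section Junction

open B13Contraction113 (QuadAnalytic)
open ShellMeasureLinearizedRealForm (realForm_chartData)

variable {𝒳 𝒴 : Type*} [NormedAddCommGroup 𝒳] [NormedSpace ℂ 𝒳] [CompleteSpace 𝒳]
  [NormedAddCommGroup 𝒴] [NormedSpace ℂ 𝒴] [CompleteSpace 𝒴]
  {hop : 𝒳 →ₗ[ℂ] 𝒴} {Ct : 𝒴 → 𝒳} {C₂ R b ε : ℝ} {Dt : 𝒴 → 𝒳}
  {κX : 𝒳 ≃ₗᵢ⋆[ℂ] 𝒳} {κY : 𝒴 ≃ₗᵢ⋆[ℂ] 𝒴}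

/-- **THE REAL CHART DATA OF THE CURVED-FIBRE ENDs FROM EXACTLY THE B12 LEAVES' BINDERS — REAL FORM CONSTRUCTED.**
Under the binders of `B12JacobianReal267` (complex `hop` with left inverse `LQ`, `C̃` quadratic-analytic and analytic on
`‖Y‖ < R`, `D̃` hypothesis-style on `‖B‖ < ε`, the couplings `9C₂bε < 1`, `3ε ≤ R`, INVOLUTIVE conjugations `κ_𝒳`, `κ_𝒴`
with equivariance of `hop` and `C̃`), on the CONSTRUCTED real forms `E := Fix(κ_𝒴)`, `F := Fix(κ_𝒳)` (§1) with
`ιE := incl κ_𝒴`, `πE := reP κ_𝒴`, `ιF := incl κ_𝒳`, `πF := reP κ_𝒳`: with `L := πF ∘ LQ ∘ ιE`, `h := πE ∘ hop ∘ ιF`,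
`C̃_ℝ := πF ∘ C̃ ∘ ιE`, `D̃_ℝ := 1_O · πF ∘ D̃ ∘ ιE`, `O := {‖ιE ·‖ < ε}` — (i) the real chart `B ↦ B − h (D̃_ℝ B)` is
MEASURABLE, (ii) INJECTIVE on `O`, (iii) has the derivative `id − h ∘ (πF ∘ DD̃(ιE B)↾ℝ ∘ ιE)` within `O`, (iv)
LINEARIZES the real average `L + C̃_ℝ` into the second coordinate of ANY splitting `Ψ` with `(Ψ.symm y).2 = L y`.
This is `ShellMeasureLinearizedRealForm.realForm_chartData` with its five real-form axioms `hιπE hιEr hιπF hιFr hπιF`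
DISCHARGED by §1 (`incl_reP_of_fixed`, `conj_incl`, `reP_incl`); the Borel / finite-dimensional structure
of `E`, `F` is inherited from `𝒴`, `𝒳`. [folklore] -/
theorem realForm_chartData_fixed [MeasurableSpace 𝒴] [BorelSpace 𝒴] [FiniteDimensional ℂ 𝒴] [MeasurableSpace 𝒳]
    [BorelSpace 𝒳] (hκX : ∀ X, κX (κX X) = X) (hκY : ∀ B, κY (κY B) = B)
    (LQ : 𝒴 →L[ℂ] 𝒳) (hLQh : ∀ X, LQ (hop X) = X)
    (hC : QuadAnalytic Ct C₂ R) (hCa : AnalyticOnNhd ℂ Ct {Y : 𝒴 | ‖Y‖ < R})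
    (hC₂ : 0 ≤ C₂) (hb : 0 ≤ b) (hHop : ∀ X, ‖hop X‖ ≤ b * ‖X‖) (hq : 9 * C₂ * b * ε < 1)
    (hRC : 3 * ε ≤ R) (hDball : ∀ B : 𝒴, ‖B‖ < ε → Dt B ∈ closedBall (0:𝒳) (4 * C₂ * ε ^ 2))
    (hDfix : ∀ B : 𝒴, ‖B‖ < ε → Ct (B - hop (Dt B)) = Dt B)
    (hhop : ∀ X, hop (κX X) = κY (hop X)) (hCt : ∀ Y : 𝒴, ‖Y‖ < R → Ct (κY Y) = κX (Ct Y))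
    {Kf : Type*} [NormedAddCommGroup Kf] [NormedSpace ℝ Kf] (Ψ : (Kf × realSub κX) ≃L[ℝ] realSub κY)
    (hΨ : ∀ y, (Ψ.symm y).2 = (reP κX hκX ∘L LQ.restrictScalars ℝ ∘L incl κY) y) :
    Measurable (fun B : realSub κY => B - (reP κY hκY ∘L (hop.mkContinuous b hHop).restrictScalars ℝ ∘L
        incl κX) (({y : realSub κY | ‖incl κY y‖ < ε}).piecewise
          (fun y => reP κX hκX (Dt (incl κY y))) 0 B)) ∧
      InjOn (fun B : realSub κY => B - (reP κY hκY ∘L (hop.mkContinuous b hHop).restrictScalars ℝ ∘L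
        incl κX) (({y : realSub κY | ‖incl κY y‖ < ε}).piecewise
          (fun y => reP κX hκX (Dt (incl κY y))) 0 B))
        {y : realSub κY | ‖incl κY y‖ < ε} ∧
      (∀ B ∈ {y : realSub κY | ‖incl κY y‖ < ε}, HasFDerivWithinAt
        (fun B : realSub κY => B - (reP κY hκY ∘L (hop.mkContinuous b hHop).restrictScalars ℝ ∘L
          incl κX) (({y : realSub κY | ‖incl κY y‖ < ε}).piecewise
            (fun y => reP κX hκX (Dt (incl κY y))) 0 B))
        (ContinuousLinearMap.id ℝ (realSub κY) - (reP κY hκY ∘L (hop.mkContinuous b hHop).restrictScalars ℝ ∘L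
          incl κX).comp (reP κX hκX ∘L (fderiv ℂ Dt (incl κY B)).restrictScalars ℝ ∘L
            incl κY)) {y : realSub κY | ‖incl κY y‖ < ε} B) ∧
      ∀ B ∈ {y : realSub κY | ‖incl κY y‖ < ε},
        (reP κX hκX ∘L LQ.restrictScalars ℝ ∘L incl κY) (B - (reP κY hκY ∘L
            (hop.mkContinuous b hHop).restrictScalars ℝ ∘L incl κX)
            (({y : realSub κY | ‖incl κY y‖ < ε}).piecewise
              (fun y => reP κX hκX (Dt (incl κY y))) 0 B)) +
          (fun y => reP κX hκX (Ct (incl κY y))) (B - (reP κY hκY ∘L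
            (hop.mkContinuous b hHop).restrictScalars ℝ ∘L incl κX)
            (({y : realSub κY | ‖incl κY y‖ < ε}).piecewise
              (fun y => reP κX hκX (Dt (incl κY y))) 0 B)) = (Ψ.symm B).2 :=
  realForm_chartData LQ hLQh hC hCa hC₂ hb hHop hq hRC hDball hDfix hκX hκY hhop hCt
    (incl_reP_of_fixed hκY) (conj_incl κY) (incl_reP_of_fixed hκX) (conj_incl κX)
    (reP_incl hκX) Ψ hΨ

end Junction

/-! ## §3 Inhabited by print's kind of real structure: `X ↦ −X⋆`, fixed points = the skew-adjoint part -/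

section NegStar

variable {A : Type*} [NormedAddCommGroup A] [StarAddMonoid A] [NormedStarGroup A] [NormedSpace ℂ A]
  [StarModule ℂ A]

/-- THE CONJUGATION `X ↦ −X⋆` of a complex normed star-module with isometric star (for matrix blocks: minus the
conjugate transpose), as a conjugate-linear isometric equivalence. [folklore] -/
def negStar : A ≃ₗᵢ⋆[ℂ] A := (starₗᵢ ℂ : A ≃ₗᵢ⋆[ℂ] A).trans (LinearIsometryEquiv.neg ℂ)

/-- `negStar X = −X⋆`. [folklore] -/
@[simp] theorem negStar_apply (X : A) : negStar X = -star X := rfl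

/-- `negStar` is INVOLUTIVE — the hypothesis `hκ` of §1–§2. [folklore] -/
theorem negStar_negStar (X : A) : negStar (negStar X) = X := by
  rw [negStar_apply, negStar_apply, star_neg, star_star, neg_neg]

/-- **the real subspace of `negStar` is the SKEW-ADJOINT (anti-Hermitian) part** — the `𝔲(n)`-TYPE real form of
`M_n(ℂ)`-valued variables. [folklore] -/
theorem mem_realSub_negStar_iff (X : A) : X ∈ realSub (negStar : A ≃ₗᵢ⋆[ℂ] A) ↔ X ∈ skewAdjoint A := by
  rw [mem_realSub, negStar_apply, skewAdjoint.mem_iff, neg_eq_iff_eq_neg]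

/-- the real-part projection of `negStar` is `X ↦ ½(X − X⋆)` (the skew-adjoint part). [folklore] -/
theorem coe_reP_negStar (X : A) :
    ((reP (negStar : A ≃ₗᵢ⋆[ℂ] A) negStar_negStar X : realSub (negStar : A ≃ₗᵢ⋆[ℂ] A)) : A) =
      (1 / 2 : ℝ) • (X - star X) := by
  rw [coe_reP, negStar_apply, sub_eq_add_neg]

end NegStar

end Summit.QuantumFields.BalabanUV.T4Continuum.ShellMeasureLinearizedRealStructure

end
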